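import Mathlib
import HarnessLib
import Summits.Ventures.LatticeQCDFlow.Scoring.RegenerativeEstimatorSharp
import Summits.Ventures.LatticeQCDFlow.Scoring.RegenerativeTourCement
import Summits.Ventures.LatticeQCDFlow.Scoring.BlockCountDomination

/-!
# The median of tour-group estimates, GENERAL FORM: any per-group badness bound `q ≤ 1/4` that holds
# from every initial law propagates to `P(#{bad groups among K} ≥ K/2) ≤ e^{−K/8}`

HONEST FRAMING: exact (Metropolis-corrected) sampling algorithms for lattice gauge theory;
figures of merit are autocorrelation/cost numbers at stated couplings and volumes; no
continuum-physics claim.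

Venture `LatticeQCDFlow` (cell pub-lqcd), topic `Scoring`; FANOUT row 8 (`s0-cpn-nemc`, GEN-17).
NEW WORK of the cell, not a published result; no definition is introduced.  Notation of
`Scoring/RegenerativeMedianOfGroups.lean` (GEN-16): group `k` = tours `k(m+1)+1, …, k(m+1)+m` (one
spacer tour between groups), `A_k` the group's tour estimate, `χ_k = 1{s ≤ |A_k − π(f)|}`.  That file
hard-wired the per-group bound `q = 4((2−ε)(2C)²/s² + (1−ε))/m` of `Scoring/RegenerativeEstimatorSharp.lean`.
Its proof uses the bound at exactly two places — for the run itself (group `0`) and for the FRESH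
split chain (every later group, after conditioning at the start of the spacer tour by the tour
theorem with the cemented past) — and is otherwise generic in `q`.  This file records the generic
statement: IF the group-of-`m`-tours estimate misses `π(f)` by `≥ s` with probability `≤ q` FROM
EVERY INITIAL LAW of the split chain, and `q ≤ 1/4`, THEN `P(Σ_{k<K} χ_k ≥ K/2) ≤ e^{−K/8}` from any
start (`π` here is only the centring law; invariance is whatever the hypothesis needed).  The
variance-sensitive instance (`q = 4(ε σ²_f/s² + (1−ε))/m`, `Scoring/RegenerativeEstimatorSigma.lean`)
is `Scoring/RegenerativeMedianOfGroupsSigma.lean`.  Printed counterpart NAMED ONLY: median-of-means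
(Nemirovsky–Yudin 1983; Devroye–Lerasle–Lugosi–Oliveira 2016) on regeneration tours
(Mykland–Tierney–Yu 1995) — nothing is cited as a fact.

## Content (`0 < ε < 1`; `|f| ≤ C` measurable; any initial law; `m ≥ 1`, `s > 0`, `0 ≤ q ≤ 1/4`)

* **`regenerative_medianOfGroups_of_groupBound`** — under the any-start group bound `≤ q`:
  `P((K : ℝ)/2 ≤ Σ_{k<K} χ_k) ≤ exp(−K/8)` for every `K`.

NOT CLAIMED: anything beyond `Scoring/RegenerativeMedianOfGroups.lean` except the generality in `q`.
-/

noncomputable section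

namespace Summit.Ventures.LatticeQCDFlow.Scoring

open MeasureTheory ProbabilityTheory Filter Finset Preorder Literature.Probability.MarkovChains
open scoped ENNReal

/-! ### The median-of-groups certificate -/

section Median

variable {Ω : Type*} [MeasurableSpace Ω]
  {κ : Kernel Ω Ω} [IsMarkovKernel κ] {ν : Measure Ω} [IsProbabilityMeasure ν] {ε : ℝ≥0∞}
  {hmin : ∀ x {B : Set Ω}, MeasurableSet B → ε * ν B ≤ κ x B}
  (κs : Kernel (Ω × Bool) (Ω × Bool)) [IsMarkovKernel κs]
  (μs : Measure (Ω × Bool)) [IsProbabilityMeasure μs]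

/-- **THE MEDIAN-OF-TOUR-GROUPS CERTIFICATE, GENERAL FORM.**  `κ(x, ·) ≥ ε ν` with `0 < ε < 1`,
`f` measurable, any initial law; group `k` = tours `k(m+1)+1, …, k(m+1)+m` with estimate
`A_k = Σ_{i<m} Y_{k(m+1)+i+1} / Σ_{i<m} N_{k(m+1)+i+1}` and `χ_k = 1{s ≤ |A_k − π(f)|}`.  If the group
estimate of tours `1..m` misses `π(f)` by `≥ s` with probability `≤ q` FROM EVERY INITIAL LAW, and
`0 ≤ q ≤ 1/4`, then for every `K`: `P((K : ℝ)/2 ≤ Σ_{k<K} χ_k) ≤ exp(−K/8)`. -/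
theorem regenerative_medianOfGroups_of_groupBound {π : Measure Ω}
    (hε0 : 0 < ε) (hε : ε < 1)
    (hκs : ∀ p, κs p = (ε • ν).map (fun y : Ω => (y, true))
      + ((1 - ε) • Doeblin.residualKernel κ ν ε hmin p.1).map (fun y : Ω => (y, false)))
    {f : Ω → ℝ} (hf : Measurable f) (m : ℕ) {s : ℝ} {q : ℝ} (hq0 : 0 ≤ q) (hq : q ≤ 1 / 4)
    (hgroup : ∀ (μ' : Measure (Ω × Bool)) [IsProbabilityMeasure μ'],
      (Kernel.trajMeasure (X := fun _ : ℕ => Ω × Bool) μ'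
        (fun n : ℕ => κs.comap (fun h : (i : ↥(Finset.Iic n)) → Ω × Bool =>
          h ⟨n, Finset.mem_Iic.2 le_rfl⟩) (measurable_pi_apply _))).real
        {y | s ≤ |(∑ i ∈ Finset.range m, ∑' u, (if (∑ s ∈ Finset.range u,
            (if (y (s + 1)).2 then (1 : ℕ) else 0)) = i + 1 then (1 : ℝ) else 0) * f (y u).1)
          / (∑ i ∈ Finset.range m, ∑' u, (if (∑ s ∈ Finset.range u,
            (if (y (s + 1)).2 then (1 : ℕ) else 0)) = i + 1 then (1 : ℝ) else 0))
          - ∫ z, f z ∂π|} ≤ q) (K : ℕ) :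
    (Kernel.trajMeasure (X := fun _ : ℕ => Ω × Bool) μs
        (fun n : ℕ => κs.comap (fun h : (i : ↥(Finset.Iic n)) → Ω × Bool =>
          h ⟨n, Finset.mem_Iic.2 le_rfl⟩) (measurable_pi_apply _))).real
      {x | (K : ℝ) / 2 ≤ ∑ k ∈ Finset.range K,
        (if s ≤ |(∑ i ∈ Finset.range m, ∑' u, (if (∑ s ∈ Finset.range u,
              (if (x (s + 1)).2 then (1 : ℕ) else 0)) = k * (m + 1) + i + 1 then (1 : ℝ) else 0)
              * f (x u).1)
            / (∑ i ∈ Finset.range m, ∑' u, (if (∑ s ∈ Finset.range u,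
              (if (x (s + 1)).2 then (1 : ℕ) else 0)) = k * (m + 1) + i + 1 then (1 : ℝ) else 0))
            - ∫ z, f z ∂π| then (1 : ℝ) else 0)}
      ≤ Real.exp (-((K : ℝ) / 8)) := by
  haveI hνt : IsProbabilityMeasure (ν.map (fun y : Ω => (y, true))) :=
    Measure.isProbabilityMeasure_map (measurable_tagCoin true).aemeasurable
  set P := Kernel.trajMeasure (X := fun _ : ℕ => Ω × Bool) μs
      (fun n : ℕ => κs.comap (fun h : (i : ↥(Finset.Iic n)) → Ω × Bool =>
        h ⟨n, Finset.mem_Iic.2 le_rfl⟩) (measurable_pi_apply _)) with hP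
  set Pν := Kernel.trajMeasure (X := fun _ : ℕ => Ω × Bool) (ν.map (fun y : Ω => (y, true)))
      (fun n : ℕ => κs.comap (fun h : (i : ↥(Finset.Iic n)) → Ω × Bool =>
        h ⟨n, Finset.mem_Iic.2 le_rfl⟩) (measurable_pi_apply _)) with hPν
  set c := ∫ z, f z ∂π with hc
  -- measurability of the tour sums, tour lengths and group indicators
  have hψ : Measurable fun pq : (Ω × Bool) × (Ω × Bool) => f pq.1.1 :=
    hf.comp (measurable_fst.comp measurable_fst)
  have hYm : ∀ a : ℕ, Measurable fun x : ℕ → Ω × Bool => ∑' u, (if (∑ s ∈ Finset.range u,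
      (if (x (s + 1)).2 then (1 : ℕ) else 0)) = a then (1 : ℝ) else 0) * f (x u).1 := fun a =>
    measurable_tourSum (Ω := Ω) (ψ := fun p _ => f p.1) hψ a
  have hNm : ∀ a : ℕ, Measurable fun x : ℕ → Ω × Bool => ∑' u, (if (∑ s ∈ Finset.range u,
      (if (x (s + 1)).2 then (1 : ℕ) else 0)) = a then (1 : ℝ) else 0) := fun a =>
    Measurable.tsum fun u => measurable_headCountIndicator u a
  have hAm : ∀ (b : ℕ → ℕ), Measurable fun x : ℕ → Ω × Bool =>
      |(∑ i ∈ Finset.range m, ∑' u, (if (∑ s ∈ Finset.range u,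
          (if (x (s + 1)).2 then (1 : ℕ) else 0)) = b i then (1 : ℝ) else 0) * f (x u).1)
        / (∑ i ∈ Finset.range m, ∑' u, (if (∑ s ∈ Finset.range u,
          (if (x (s + 1)).2 then (1 : ℕ) else 0)) = b i then (1 : ℝ) else 0)) - c| := fun b =>
    (((Finset.measurable_sum _ fun i _ => hYm (b i)).div
      (Finset.measurable_sum _ fun i _ => hNm (b i))).sub_const c).abs
  have hχm : ∀ k : ℕ, Measurable fun x : ℕ → Ω × Bool =>
      (if s ≤ |(∑ i ∈ Finset.range m, ∑' u, (if (∑ s ∈ Finset.range u,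
          (if (x (s + 1)).2 then (1 : ℕ) else 0)) = k * (m + 1) + i + 1 then (1 : ℝ) else 0)
          * f (x u).1)
        / (∑ i ∈ Finset.range m, ∑' u, (if (∑ s ∈ Finset.range u,
          (if (x (s + 1)).2 then (1 : ℕ) else 0)) = k * (m + 1) + i + 1 then (1 : ℝ) else 0))
        - c| then (1 : ℝ) else 0) := fun k =>
    Measurable.ite (measurableSet_le measurable_const (hAm fun i => k * (m + 1) + i + 1))
      measurable_const measurable_const
  -- the fresh chain's group is bad with probability `≤ q`
  have hbad : MeasurableSet {y : ℕ → Ω × Bool | s ≤ |(∑ i ∈ Finset.range m, ∑' u,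
      (if (∑ s ∈ Finset.range u, (if (y (s + 1)).2 then (1 : ℕ) else 0)) = i + 1
        then (1 : ℝ) else 0) * f (y u).1)
      / (∑ i ∈ Finset.range m, ∑' u, (if (∑ s ∈ Finset.range u,
        (if (y (s + 1)).2 then (1 : ℕ) else 0)) = i + 1 then (1 : ℝ) else 0)) - c|} :=
    measurableSet_le measurable_const (hAm fun i => i + 1)
  have hHm : Measurable fun y : ℕ → Ω × Bool => (if s ≤ |(∑ i ∈ Finset.range m, ∑' u,
      (if (∑ s ∈ Finset.range u, (if (y (s + 1)).2 then (1 : ℕ) else 0)) = i + 1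
        then (1 : ℝ) else 0) * f (y u).1)
      / (∑ i ∈ Finset.range m, ∑' u, (if (∑ s ∈ Finset.range u,
        (if (y (s + 1)).2 then (1 : ℕ) else 0)) = i + 1 then (1 : ℝ) else 0)) - c|
      then (1 : ℝ) else 0) := Measurable.ite hbad measurable_const measurable_const
  have hHint : ∀ (μ' : Measure (ℕ → Ω × Bool)) [IsProbabilityMeasure μ'],
      ∫ y, (if s ≤ |(∑ i ∈ Finset.range m, ∑' u,
        (if (∑ s ∈ Finset.range u, (if (y (s + 1)).2 then (1 : ℕ) else 0)) = i + 1
          then (1 : ℝ) else 0) * f (y u).1)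
        / (∑ i ∈ Finset.range m, ∑' u, (if (∑ s ∈ Finset.range u,
          (if (y (s + 1)).2 then (1 : ℕ) else 0)) = i + 1 then (1 : ℝ) else 0)) - c|
        then (1 : ℝ) else 0) ∂μ'
      = μ'.real {y : ℕ → Ω × Bool | s ≤ |(∑ i ∈ Finset.range m, ∑' u,
        (if (∑ s ∈ Finset.range u, (if (y (s + 1)).2 then (1 : ℕ) else 0)) = i + 1
          then (1 : ℝ) else 0) * f (y u).1)
        / (∑ i ∈ Finset.range m, ∑' u, (if (∑ s ∈ Finset.range u,
          (if (y (s + 1)).2 then (1 : ℕ) else 0)) = i + 1 then (1 : ℝ) else 0)) - c|} := by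
    intro μ' _
    rw [← integral_indicator_one hbad]
    exact integral_congr_ae (ae_of_all _ fun y => by
      simp only [Set.indicator_apply, Set.mem_setOf_eq, Pi.one_apply])
  have hfresh : ∫ y, (if s ≤ |(∑ i ∈ Finset.range m, ∑' u,
      (if (∑ s ∈ Finset.range u, (if (y (s + 1)).2 then (1 : ℕ) else 0)) = i + 1
        then (1 : ℝ) else 0) * f (y u).1)
      / (∑ i ∈ Finset.range m, ∑' u, (if (∑ s ∈ Finset.range u,
        (if (y (s + 1)).2 then (1 : ℕ) else 0)) = i + 1 then (1 : ℝ) else 0)) - c|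
      then (1 : ℝ) else 0) ∂Pν ≤ q := by
    rw [hHint Pν, hPν]
    exact hgroup _
  refine measureReal_countGe_half_le_exp P hχm (fun k x => by
    split_ifs
    · exact Or.inr rfl
    · exact Or.inl rfl) hq0 hq ?_ K
  intro k c0
  rcases k with _ | k'
  · -- group `0` = tours `1, …, m` of the run itself
    simp only [Finset.range_zero, Finset.sum_empty, zero_mul, zero_add]
    by_cases hc0 : c0 = 0
    · subst hc0
      simp only [Nat.cast_zero, if_true, one_mul, Set.setOf_true, probReal_univ, mul_one]
      rw [hHint P, hP]
      exact hgroup _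
    · have hc0' : ¬ ((0 : ℝ) = (c0 : ℝ)) := fun h => hc0 (by exact_mod_cast h.symm)
      simp only [hc0', if_false, zero_mul, integral_zero, Set.setOf_false, measureReal_empty,
        mul_zero, le_refl]
  · -- group `k' + 1`: condition on the start of the spacer tour `(k'+1)(m+1) = j + 1`
    set j : ℕ := k' * (m + 1) + m with hjdef
    have hj : (k' + 1) * (m + 1) = j + 1 := by rw [hjdef]; ring
    have hidx : ∀ k'' ∈ Finset.range (k' + 1), ∀ i ∈ Finset.range m, k'' * (m + 1) + i + 1 ≤ j := by
      intro k'' hk'' i hi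
      have h1 : k'' ≤ k' := by have := Finset.mem_range.1 hk''; omega
      have h2 : k'' * (m + 1) ≤ k' * (m + 1) := Nat.mul_le_mul_right _ h1
      have h3 := Finset.mem_range.1 hi
      rw [hjdef]; omega
    -- the past functional `Φ = 1{#bad groups < k'+1 = c0}` and the weights `Φ ∘ cement_t`
    have hΦm : Measurable fun y : ℕ → Ω × Bool => (if (∑ k'' ∈ Finset.range (k' + 1),
        (if s ≤ |(∑ i ∈ Finset.range m, ∑' u, (if (∑ s ∈ Finset.range u,
            (if (y (s + 1)).2 then (1 : ℕ) else 0)) = k'' * (m + 1) + i + 1 then (1 : ℝ) else 0)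
            * f (y u).1)
          / (∑ i ∈ Finset.range m, ∑' u, (if (∑ s ∈ Finset.range u,
            (if (y (s + 1)).2 then (1 : ℕ) else 0)) = k'' * (m + 1) + i + 1 then (1 : ℝ) else 0))
          - c| then (1 : ℝ) else 0)) = (c0 : ℝ) then (1 : ℝ) else 0) :=
      Measurable.ite ((Finset.measurable_sum _ fun k'' _ => hχm k'') (measurableSet_singleton _))
        measurable_const measurable_const
    have hGm := fun t : ℕ => hΦm.comp (measurable_cement (Ω := Ω) t)
    have hGd := fun t : ℕ => dependsOn_comp_cement (fun y : ℕ → Ω × Bool =>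
      (if (∑ k'' ∈ Finset.range (k' + 1),
        (if s ≤ |(∑ i ∈ Finset.range m, ∑' u, (if (∑ s ∈ Finset.range u,
            (if (y (s + 1)).2 then (1 : ℕ) else 0)) = k'' * (m + 1) + i + 1 then (1 : ℝ) else 0)
            * f (y u).1)
          / (∑ i ∈ Finset.range m, ∑' u, (if (∑ s ∈ Finset.range u,
            (if (y (s + 1)).2 then (1 : ℕ) else 0)) = k'' * (m + 1) + i + 1 then (1 : ℝ) else 0))
          - c| then (1 : ℝ) else 0)) = (c0 : ℝ) then (1 : ℝ) else 0)) t
    have hGC : ∀ (t : ℕ) (x : ℕ → Ω × Bool), |((fun y : ℕ → Ω × Bool =>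
      (if (∑ k'' ∈ Finset.range (k' + 1),
        (if s ≤ |(∑ i ∈ Finset.range m, ∑' u, (if (∑ s ∈ Finset.range u,
            (if (y (s + 1)).2 then (1 : ℕ) else 0)) = k'' * (m + 1) + i + 1 then (1 : ℝ) else 0)
            * f (y u).1)
          / (∑ i ∈ Finset.range m, ∑' u, (if (∑ s ∈ Finset.range u,
            (if (y (s + 1)).2 then (1 : ℕ) else 0)) = k'' * (m + 1) + i + 1 then (1 : ℝ) else 0))
          - c| then (1 : ℝ) else 0)) = (c0 : ℝ) then (1 : ℝ) else 0)) ∘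
        (fun (x : ℕ → Ω × Bool) (n : ℕ) => if n ≤ t then x n else ((x t).1, true))) x| ≤ 1 := by
      intro t x
      simp only [Function.comp_apply]
      split_ifs <;> simp
    have hHi : Integrable (fun y : ℕ → Ω × Bool => (if s ≤ |(∑ i ∈ Finset.range m, ∑' u,
        (if (∑ s ∈ Finset.range u, (if (y (s + 1)).2 then (1 : ℕ) else 0)) = i + 1
          then (1 : ℝ) else 0) * f (y u).1)
        / (∑ i ∈ Finset.range m, ∑' u, (if (∑ s ∈ Finset.range u,
          (if (y (s + 1)).2 then (1 : ℕ) else 0)) = i + 1 then (1 : ℝ) else 0)) - c|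
        then (1 : ℝ) else 0)) Pν :=
      integrable_of_bounded Pν hHm (C := 1) fun y => by split_ifs <;> simp
    have key := splitChain_tour_regeneration κs μs (κ := κ) (ν := ν) (hmin := hmin) hε hκs j hGm hGd
      hGC hHm hHi
    rw [← hP, ← hPν] at key
    simp only [Function.comp_apply] at key
    -- almost surely: identify the integrands
    have hae := splitChain_ae_tourStart κs μs (κ := κ) (ν := ν) (hmin := hmin) hε0 hε hκs
    rw [← hP] at hae
    -- pathwise facts at the start `t₀ + 1` of tour `j + 1`
    have hpast : ∀ (x : ℕ → Ω × Bool) (t₀ : ℕ),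
        (∑ s ∈ Finset.range t₀, (if (x (s + 1)).2 then (1 : ℕ) else 0)) = j →
        (x (t₀ + 1)).2 = true →
        (∑ k'' ∈ Finset.range (k' + 1),
          (if s ≤ |(∑ i ∈ Finset.range m, ∑' u, (if (∑ s ∈ Finset.range u,
              (if (if s + 1 ≤ t₀ then x (s + 1) else ((x t₀).1, true)).2 then (1 : ℕ) else 0))
              = k'' * (m + 1) + i + 1 then (1 : ℝ) else 0)
              * f (if u ≤ t₀ then x u else ((x t₀).1, true)).1)
            / (∑ i ∈ Finset.range m, ∑' u, (if (∑ s ∈ Finset.range u,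
              (if (if s + 1 ≤ t₀ then x (s + 1) else ((x t₀).1, true)).2 then (1 : ℕ) else 0))
              = k'' * (m + 1) + i + 1 then (1 : ℝ) else 0))
            - c| then (1 : ℝ) else 0))
        = ∑ k'' ∈ Finset.range (k' + 1),
          (if s ≤ |(∑ i ∈ Finset.range m, ∑' u, (if (∑ s ∈ Finset.range u,
              (if (x (s + 1)).2 then (1 : ℕ) else 0)) = k'' * (m + 1) + i + 1 then (1 : ℝ) else 0)
              * f (x u).1)
            / (∑ i ∈ Finset.range m, ∑' u, (if (∑ s ∈ Finset.range u,
              (if (x (s + 1)).2 then (1 : ℕ) else 0)) = k'' * (m + 1) + i + 1 then (1 : ℝ) else 0))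
            - c| then (1 : ℝ) else 0) := by
      intro x t₀ ht₀ hh₀
      refine Finset.sum_congr rfl fun k'' hk'' => ?_
      have hY : ∀ i ∈ Finset.range m, (∑' u, (if (∑ s ∈ Finset.range u,
            (if (if s + 1 ≤ t₀ then x (s + 1) else ((x t₀).1, true)).2 then (1 : ℕ) else 0))
            = k'' * (m + 1) + i + 1 then (1 : ℝ) else 0)
            * f (if u ≤ t₀ then x u else ((x t₀).1, true)).1)
          = ∑' u, (if (∑ s ∈ Finset.range u, (if (x (s + 1)).2 then (1 : ℕ) else 0))
            = k'' * (m + 1) + i + 1 then (1 : ℝ) else 0) * f (x u).1 := fun i hi =>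
        tourSum_cement f x (hidx k'' hk'' i hi) ht₀ hh₀
      have hN : ∀ i ∈ Finset.range m, (∑' u, (if (∑ s ∈ Finset.range u,
            (if (if s + 1 ≤ t₀ then x (s + 1) else ((x t₀).1, true)).2 then (1 : ℕ) else 0))
            = k'' * (m + 1) + i + 1 then (1 : ℝ) else 0))
          = ∑' u, (if (∑ s ∈ Finset.range u, (if (x (s + 1)).2 then (1 : ℕ) else 0))
            = k'' * (m + 1) + i + 1 then (1 : ℝ) else 0) := fun i hi =>
        tourLength_cement x (hidx k'' hk'' i hi) ht₀ hh₀
      rw [Finset.sum_congr rfl hY, Finset.sum_congr rfl hN]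
    have hfut : ∀ (x : ℕ → Ω × Bool) (t₀ : ℕ),
        (∑ s ∈ Finset.range t₀, (if (x (s + 1)).2 then (1 : ℕ) else 0)) = j →
        (x (t₀ + 1)).2 = true →
        (if s ≤ |(∑ i ∈ Finset.range m, ∑' u,
            (if (∑ s ∈ Finset.range u, (if (x (t₀ + 1 + (s + 1))).2 then (1 : ℕ) else 0)) = i + 1
              then (1 : ℝ) else 0) * f (x (t₀ + 1 + u)).1)
            / (∑ i ∈ Finset.range m, ∑' u, (if (∑ s ∈ Finset.range u,
              (if (x (t₀ + 1 + (s + 1))).2 then (1 : ℕ) else 0)) = i + 1 then (1 : ℝ) else 0)) - c|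
            then (1 : ℝ) else 0)
        = (if s ≤ |(∑ i ∈ Finset.range m, ∑' u, (if (∑ s ∈ Finset.range u,
              (if (x (s + 1)).2 then (1 : ℕ) else 0)) = (k' + 1) * (m + 1) + i + 1
              then (1 : ℝ) else 0) * f (x u).1)
            / (∑ i ∈ Finset.range m, ∑' u, (if (∑ s ∈ Finset.range u,
              (if (x (s + 1)).2 then (1 : ℕ) else 0)) = (k' + 1) * (m + 1) + i + 1
              then (1 : ℝ) else 0)) - c| then (1 : ℝ) else 0) := by
      intro x t₀ ht₀ hh₀
      have hY : ∀ i ∈ Finset.range m, (∑' u,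
            (if (∑ s ∈ Finset.range u, (if (x (t₀ + 1 + (s + 1))).2 then (1 : ℕ) else 0)) = i + 1
              then (1 : ℝ) else 0) * f (x (t₀ + 1 + u)).1)
          = ∑' u, (if (∑ s ∈ Finset.range u, (if (x (s + 1)).2 then (1 : ℕ) else 0))
            = (k' + 1) * (m + 1) + i + 1 then (1 : ℝ) else 0) * f (x u).1 := by
        intro i _
        rw [show (k' + 1) * (m + 1) + i + 1 = j + 1 + (i + 1) by rw [hj]; ring]
        exact (tourSum_transport_add (fun p _ => f p.1) x ht₀ hh₀ (i + 1)).symm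
      have hN : ∀ i ∈ Finset.range m, (∑' u,
            (if (∑ s ∈ Finset.range u, (if (x (t₀ + 1 + (s + 1))).2 then (1 : ℕ) else 0)) = i + 1
              then (1 : ℝ) else 0))
          = ∑' u, (if (∑ s ∈ Finset.range u, (if (x (s + 1)).2 then (1 : ℕ) else 0))
            = (k' + 1) * (m + 1) + i + 1 then (1 : ℝ) else 0) := by
        intro i _
        rw [show (k' + 1) * (m + 1) + i + 1 = j + 1 + (i + 1) by rw [hj]; ring]
        have h := (tourSum_transport_add (fun _ _ => (1 : ℝ)) x ht₀ hh₀ (i + 1)).symm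
        simp only [mul_one] at h
        exact h
      rw [Finset.sum_congr rfl hY, Finset.sum_congr rfl hN]
    -- vanishing of the weights away from the tour start
    have hzero : ∀ (x : ℕ → Ω × Bool) (t₀ : ℕ),
        (∑ s ∈ Finset.range t₀, (if (x (s + 1)).2 then (1 : ℕ) else 0)) = j →
        (x (t₀ + 1)).2 = true → ∀ (a w : ℕ → ℝ) (t : ℕ), t ≠ t₀ →
        a t * (if (∑ s ∈ Finset.range t, (if (x (s + 1)).2 then (1 : ℕ) else 0)) = j
          then (1 : ℝ) else 0) * (if (x (t + 1)).2 then (1 : ℝ) else 0) * w t = 0 := by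
      intro x t₀ ht₀ hh₀ a w t hne
      by_cases h1 : (∑ s ∈ Finset.range t, (if (x (s + 1)).2 then (1 : ℕ) else 0)) = j
      · have h2 : ¬ (x (t + 1)).2 = true := fun h2 => hne (tourStart_unique x h1 h2 ht₀ hh₀)
        rw [if_neg h2, mul_zero, zero_mul]
      · rw [if_neg h1, mul_zero, zero_mul, zero_mul]
    have hzero' : ∀ (x : ℕ → Ω × Bool) (t₀ : ℕ),
        (∑ s ∈ Finset.range t₀, (if (x (s + 1)).2 then (1 : ℕ) else 0)) = j →
        (x (t₀ + 1)).2 = true → ∀ (a : ℕ → ℝ) (t : ℕ), t ≠ t₀ →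
        a t * (if (∑ s ∈ Finset.range t, (if (x (s + 1)).2 then (1 : ℕ) else 0)) = j
          then (1 : ℝ) else 0) * (if (x (t + 1)).2 then (1 : ℝ) else 0) = 0 := by
      intro x t₀ ht₀ hh₀ a t hne
      have h := hzero x t₀ ht₀ hh₀ a (fun _ => 1) t hne
      rwa [mul_one] at h
    -- the two almost-sure identities
    have hid1 : ∀ᵐ x ∂P, (∑' t, (if (∑ k'' ∈ Finset.range (k' + 1),
          (if s ≤ |(∑ i ∈ Finset.range m, ∑' u, (if (∑ s ∈ Finset.range u,
              (if (if s + 1 ≤ t then x (s + 1) else ((x t).1, true)).2 then (1 : ℕ) else 0))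
              = k'' * (m + 1) + i + 1 then (1 : ℝ) else 0)
              * f (if u ≤ t then x u else ((x t).1, true)).1)
            / (∑ i ∈ Finset.range m, ∑' u, (if (∑ s ∈ Finset.range u,
              (if (if s + 1 ≤ t then x (s + 1) else ((x t).1, true)).2 then (1 : ℕ) else 0))
              = k'' * (m + 1) + i + 1 then (1 : ℝ) else 0))
            - c| then (1 : ℝ) else 0)) = (c0 : ℝ) then (1 : ℝ) else 0)
        * (if (∑ s ∈ Finset.range t, (if (x (s + 1)).2 then (1 : ℕ) else 0)) = j
          then (1 : ℝ) else 0) * (if (x (t + 1)).2 then (1 : ℝ) else 0)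
        * (if s ≤ |(∑ i ∈ Finset.range m, ∑' u,
            (if (∑ s ∈ Finset.range u, (if (x (t + 1 + (s + 1))).2 then (1 : ℕ) else 0)) = i + 1
              then (1 : ℝ) else 0) * f (x (t + 1 + u)).1)
            / (∑ i ∈ Finset.range m, ∑' u, (if (∑ s ∈ Finset.range u,
              (if (x (t + 1 + (s + 1))).2 then (1 : ℕ) else 0)) = i + 1 then (1 : ℝ) else 0)) - c|
            then (1 : ℝ) else 0))
      = (if (∑ k'' ∈ Finset.range (k' + 1),
          (if s ≤ |(∑ i ∈ Finset.range m, ∑' u, (if (∑ s ∈ Finset.range u,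
              (if (x (s + 1)).2 then (1 : ℕ) else 0)) = k'' * (m + 1) + i + 1 then (1 : ℝ) else 0)
              * f (x u).1)
            / (∑ i ∈ Finset.range m, ∑' u, (if (∑ s ∈ Finset.range u,
              (if (x (s + 1)).2 then (1 : ℕ) else 0)) = k'' * (m + 1) + i + 1 then (1 : ℝ) else 0))
            - c| then (1 : ℝ) else 0)) = (c0 : ℝ) then (1 : ℝ) else 0)
        * (if s ≤ |(∑ i ∈ Finset.range m, ∑' u, (if (∑ s ∈ Finset.range u,
              (if (x (s + 1)).2 then (1 : ℕ) else 0)) = (k' + 1) * (m + 1) + i + 1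
              then (1 : ℝ) else 0) * f (x u).1)
            / (∑ i ∈ Finset.range m, ∑' u, (if (∑ s ∈ Finset.range u,
              (if (x (s + 1)).2 then (1 : ℕ) else 0)) = (k' + 1) * (m + 1) + i + 1
              then (1 : ℝ) else 0)) - c| then (1 : ℝ) else 0) := by
      filter_upwards [hae] with x hx
      obtain ⟨t₀, ht₀, hh₀⟩ := hx j
      rw [tsum_eq_single t₀ (hzero x t₀ ht₀ hh₀ _ _), if_pos ht₀, if_pos hh₀, mul_one, mul_one,
        hpast x t₀ ht₀ hh₀, hfut x t₀ ht₀ hh₀]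
    have hid2 : ∀ᵐ x ∂P, (∑' t, (if (∑ k'' ∈ Finset.range (k' + 1),
          (if s ≤ |(∑ i ∈ Finset.range m, ∑' u, (if (∑ s ∈ Finset.range u,
              (if (if s + 1 ≤ t then x (s + 1) else ((x t).1, true)).2 then (1 : ℕ) else 0))
              = k'' * (m + 1) + i + 1 then (1 : ℝ) else 0)
              * f (if u ≤ t then x u else ((x t).1, true)).1)
            / (∑ i ∈ Finset.range m, ∑' u, (if (∑ s ∈ Finset.range u,
              (if (if s + 1 ≤ t then x (s + 1) else ((x t).1, true)).2 then (1 : ℕ) else 0))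
              = k'' * (m + 1) + i + 1 then (1 : ℝ) else 0))
            - c| then (1 : ℝ) else 0)) = (c0 : ℝ) then (1 : ℝ) else 0)
        * (if (∑ s ∈ Finset.range t, (if (x (s + 1)).2 then (1 : ℕ) else 0)) = j
          then (1 : ℝ) else 0) * (if (x (t + 1)).2 then (1 : ℝ) else 0))
      = (if (∑ k'' ∈ Finset.range (k' + 1),
          (if s ≤ |(∑ i ∈ Finset.range m, ∑' u, (if (∑ s ∈ Finset.range u,
              (if (x (s + 1)).2 then (1 : ℕ) else 0)) = k'' * (m + 1) + i + 1 then (1 : ℝ) else 0)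
              * f (x u).1)
            / (∑ i ∈ Finset.range m, ∑' u, (if (∑ s ∈ Finset.range u,
              (if (x (s + 1)).2 then (1 : ℕ) else 0)) = k'' * (m + 1) + i + 1 then (1 : ℝ) else 0))
            - c| then (1 : ℝ) else 0)) = (c0 : ℝ) then (1 : ℝ) else 0) := by
      filter_upwards [hae] with x hx
      obtain ⟨t₀, ht₀, hh₀⟩ := hx j
      rw [tsum_eq_single t₀ (hzero' x t₀ ht₀ hh₀ _), if_pos ht₀, if_pos hh₀, mul_one, mul_one,
        hpast x t₀ ht₀ hh₀]
    -- assemble the one-sided conditional bound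
    rw [measureReal_countEq_eq_integral P hχm (k' + 1) (c0 : ℝ), ← integral_congr_ae hid1, key,
      integral_congr_ae hid2, mul_comm]
    exact mul_le_mul_of_nonneg_right hfresh (integral_nonneg fun x => by
      positivity)

end Median

end Summit.Ventures.LatticeQCDFlow.Scoring

end
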